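import Summits.ValiantsHypothesis.ValiantsHypothesis.Theorems.BarrierLeverChowBenchmarkPairsZeonNoGo

/-!
# Route BarrierLever — item 22038 `ChowBenchmarkPairs`, line `moore-peel`: zeon-orthogonality no-go's THROUGH THE ORIGIN
# (general point tables)

Helper file (`--supports stmt-ValiantsHypothesis-22038`; cell valiant-natproofs, rung V4, 𝒟-side benchmark of record; seat val-np-p4 gen 20;
companion of `…ChowBenchmarkPairsZeonNoGo` (p635499)).  Closes NO item.

The origin `P_0 = 0` is a point of every configuration (`R_0 = 1`: row `∅`, rows `{a} = {0,a}`), and since `R_0² = R_0` the zeon product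
relations `X·Y = 0` of the ZeonNoGo file may SHARE it.  Two rules:
* `det_eq_zero_of_orthogonal_mixed`: if the difference `P_b − P_a` is zeon-orthogonal to the point `P_c` on every benchmark column
  (`δ_x P_{c,x'} + δ_{x'} P_{c,x} = 0` for distinct `x, x'` in the column), then `row{b,c} − row{a,c} − row{b} + row{a} = 0`
  (`(R_b − R_a)(R_c − 1) = R_aR_bR_c·L_δ L_c`);
* `det_eq_zero_of_orthogonal_points`: if `P_a`, `P_b` are zeon-orthogonal on every column (e.g. their supports meet no common column pair),
  then `row{a,b} − row{a} − row{b} + row ∅ = 0` (`(R_a − 1)(R_b − 1) = R_aR_b·L_aL_b`).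
Motivation: the g20 completeness census of 0/1 designs (HOME/val-np-p4/g20/num/job7; h = 5 exhaustive, 2 840 singular designs out of 3 003):
the mixed rule alone explains 1 848 of them; with the hyperplane / crowding / support-crowding counts and the four-point rule all but 4.

WHAT THIS IS NOT: a constraint on witnesses of the ∀h stubs only; no stub of the line is closed; nothing on items 20172 / 19717, crux
stmt-ValiantsHypothesis-14610, or `VP` versus `VNP`.
-/

set_option linter.dupNamespace false

namespace Summit.ValiantsHypothesis.ValiantsHypothesis.Theorems.BarrierLever.ChowBenchmarkHyperplane

open Finset MvPolynomial
open Summit.ValiantsHypothesis.ValiantsHypothesis.Theorems.BarrierLever.MoorePeel (benchCols)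

variable {h : ℕ}

noncomputable section

/-! ## 1. The variants through the origin -/

/-!
The origin `P_0 = 0` is a point of the configuration with `R_0 = 1` (row `∅`, rows `{a} = {0, a}`); since `R_0² = R_0` the zeon
product relations may SHARE the origin.  Two more instances of `X·Y = 0`, both ubiquitous among singular 0/1 designs (g20 census,
HOME/val-np-p4/g20/num/job7: at h = 5 the mixed rule alone explains 1 848 of the 2 840 singular 0/1 designs):
`(R_b − R_a)(R_c − 1) = R_aR_bR_c·L_{P_b − P_a}·L_{P_c}` (mixed) and `(R_a − 1)(R_b − 1) = R_aR_b·L_{P_a}L_{P_b}` (both through the origin). -/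

/-- The squarefree coefficients of `1`: `[T = ∅]`. -/
theorem coeff_expo0_one (T : Finset (Fin h)) : coeff (expo0 T) (1 : MvPolynomial (Fin (h + h)) ℂ) = if T = ∅ then 1 else 0 := by
  classical
  have e := ChowCube.thetaHat_empty_row (R := ℂ) (fun (_ : Fin h) (_ : Fin h) => (0 : ℂ)) T
  rw [Finset.prod_empty] at e
  unfold expo0
  exact e

/-- `1 − A_a = −L_{P_a}`. -/
theorem one_sub_affY (q : Fin h → Fin h → ℂ) (a : Fin h) : 1 - affY q a = -linY (fun c => q a c) := by
  unfold affY linY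
  ring

/-- **Mixed zeon-orthogonality (through the origin).**  If `(P_b − P_a)` and `P_c` are zeon-orthogonal on the column `T`
(`δ_x P_{c,x'} + δ_{x'} P_{c,x} = 0` for distinct `x, x' ∈ T`, `δ = P_b − P_a`), then
`pairSum q b c T − pairSum q a c T − |T|!·q_b^T + |T|!·q_a^T = 0`. -/
theorem pairSum_orthogonal_mixed (q : Fin h → Fin h → ℂ) {a b c : Fin h} (hac : a ≠ c) (hbc : b ≠ c)
    (T : Finset (Fin h))
    (hyp : ∀ x ∈ T, ∀ x' ∈ T, x ≠ x' → (q b x - q a x) * q c x' + (q b x' - q a x') * q c x = 0) :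
    pairSum q b c T - pairSum q a c T - ((T.card.factorial : ℂ) * ∏ x ∈ T, q b x) +
      ((T.card.factorial : ℂ) * ∏ x ∈ T, q a x) = 0 := by
  classical
  have key : coeff (expo0 T) (tinvPoly q b * tinvPoly q c) - coeff (expo0 T) (tinvPoly q a * tinvPoly q c)
      - coeff (expo0 T) (tinvPoly q b) + coeff (expo0 T) (tinvPoly q a) = 0 := by
    have e1 : coeff (expo0 T) (tinvPoly q b * tinvPoly q c) =
        coeff (expo0 T) (tinvPoly q b * tinvPoly q c * (tinvPoly q a * affY q a)) := by rw [coeff_mul_tinv_affY]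
    have e2 : coeff (expo0 T) (tinvPoly q a * tinvPoly q c) =
        coeff (expo0 T) (tinvPoly q a * tinvPoly q c * (tinvPoly q b * affY q b)) := by rw [coeff_mul_tinv_affY]
    have e3 : coeff (expo0 T) (tinvPoly q b) =
        coeff (expo0 T) (tinvPoly q b * (tinvPoly q a * affY q a) * (tinvPoly q c * affY q c)) := by
      rw [coeff_mul_tinv_affY, coeff_mul_tinv_affY]
    have e4 : coeff (expo0 T) (tinvPoly q a) =
        coeff (expo0 T) (tinvPoly q a * (tinvPoly q b * affY q b) * (tinvPoly q c * affY q c)) := by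
      rw [coeff_mul_tinv_affY, coeff_mul_tinv_affY]
    rw [e1, e2, e3, e4, ← coeff_sub, ← coeff_sub, ← coeff_add]
    have e : (tinvPoly q b * tinvPoly q c * (tinvPoly q a * affY q a) -
        tinvPoly q a * tinvPoly q c * (tinvPoly q b * affY q b) -
        tinvPoly q b * (tinvPoly q a * affY q a) * (tinvPoly q c * affY q c) +
        tinvPoly q a * (tinvPoly q b * affY q b) * (tinvPoly q c * affY q c) : MvPolynomial (Fin (h + h)) ℂ) =
        -((tinvPoly q a * tinvPoly q b * tinvPoly q c) * (affY q b - affY q a) * (1 - affY q c)) := by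
      ring
    rw [e, coeff_neg, affY_sub_affY, one_sub_affY, mul_neg, coeff_neg, neg_neg, coeff_mul_linY_mul_linY]
    exact double_sum_eq_zero T
      (fun S => coeff (expo0 S) (tinvPoly q a * tinvPoly q b * tinvPoly q c))
      (fun x => q b x - q a x) (fun x => q c x) hyp
  rw [coeff_tinv_mul_tinv q hbc, coeff_tinv_mul_tinv q hac, coeff_tinvPoly, coeff_tinvPoly] at key
  have hu : ((-1 : ℂ) ^ T.card) ≠ 0 := pow_ne_zero _ (by norm_num)
  have : (-1 : ℂ) ^ T.card * (pairSum q b c T - pairSum q a c T - ((T.card.factorial : ℂ) * ∏ x ∈ T, q b x) +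
      ((T.card.factorial : ℂ) * ∏ x ∈ T, q a x)) = 0 := by
    rw [← key]; ring
  exact (mul_eq_zero.mp this).resolve_left hu

/-- **Zeon-orthogonality of two points (both through the origin).**  If `P_a` and `P_b` are zeon-orthogonal on the column `T`, then
`pairSum q a b T − |T|!·q_a^T − |T|!·q_b^T + [T = ∅] = 0`. -/
theorem pairSum_orthogonal_origin (q : Fin h → Fin h → ℂ) {a b : Fin h} (hab : a ≠ b) (T : Finset (Fin h))
    (hyp : ∀ x ∈ T, ∀ x' ∈ T, x ≠ x' → q a x * q b x' + q a x' * q b x = 0) :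
    pairSum q a b T - ((T.card.factorial : ℂ) * ∏ x ∈ T, q a x) - ((T.card.factorial : ℂ) * ∏ x ∈ T, q b x) +
      (if T = ∅ then 1 else 0) = 0 := by
  classical
  have key : coeff (expo0 T) (tinvPoly q a * tinvPoly q b) - coeff (expo0 T) (tinvPoly q a)
      - coeff (expo0 T) (tinvPoly q b) + coeff (expo0 T) (1 : MvPolynomial (Fin (h + h)) ℂ) = 0 := by
    have e1 : coeff (expo0 T) (tinvPoly q a) = coeff (expo0 T) (tinvPoly q a * (tinvPoly q b * affY q b)) := by
      rw [coeff_mul_tinv_affY]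
    have e2 : coeff (expo0 T) (tinvPoly q b) = coeff (expo0 T) (tinvPoly q b * (tinvPoly q a * affY q a)) := by
      rw [coeff_mul_tinv_affY]
    have e3 : coeff (expo0 T) (1 : MvPolynomial (Fin (h + h)) ℂ) =
        coeff (expo0 T) (1 * (tinvPoly q a * affY q a) * (tinvPoly q b * affY q b)) := by
      rw [coeff_mul_tinv_affY, coeff_mul_tinv_affY]
    rw [e1, e2, e3, ← coeff_sub, ← coeff_sub, ← coeff_add]
    have e : (tinvPoly q a * tinvPoly q b - tinvPoly q a * (tinvPoly q b * affY q b) -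
        tinvPoly q b * (tinvPoly q a * affY q a) + 1 * (tinvPoly q a * affY q a) * (tinvPoly q b * affY q b) :
          MvPolynomial (Fin (h + h)) ℂ) =
        (tinvPoly q a * tinvPoly q b) * (1 - affY q a) * (1 - affY q b) := by
      ring
    have e' : (tinvPoly q a * tinvPoly q b - tinvPoly q a * (tinvPoly q b * affY q b) -
        tinvPoly q b * (tinvPoly q a * affY q a) + 1 * (tinvPoly q a * affY q a) * (tinvPoly q b * affY q b) :
          MvPolynomial (Fin (h + h)) ℂ) =
        (tinvPoly q a * tinvPoly q b) * linY (fun c => q a c) * linY (fun c => q b c) := by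
      rw [e, one_sub_affY, one_sub_affY]; ring
    rw [e', coeff_mul_linY_mul_linY]
    exact double_sum_eq_zero T (fun S => coeff (expo0 S) (tinvPoly q a * tinvPoly q b))
      (fun x => q a x) (fun x => q b x) hyp
  rw [coeff_tinv_mul_tinv q hab, coeff_tinvPoly, coeff_tinvPoly, coeff_expo0_one] at key
  have hu : ((-1 : ℂ) ^ T.card) ≠ 0 := pow_ne_zero _ (by norm_num)
  have hite : (-1 : ℂ) ^ T.card * (if T = ∅ then (1 : ℂ) else 0) = (if T = ∅ then 1 else 0) := by
    by_cases hT : T = ∅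
    · subst hT; simp
    · rw [if_neg hT, mul_zero]
  have : (-1 : ℂ) ^ T.card * (pairSum q a b T - ((T.card.factorial : ℂ) * ∏ x ∈ T, q a x) -
      ((T.card.factorial : ℂ) * ∏ x ∈ T, q b x) + (if T = ∅ then 1 else 0)) = 0 := by
    have split : (-1 : ℂ) ^ T.card * (pairSum q a b T - ((T.card.factorial : ℂ) * ∏ x ∈ T, q a x) -
        ((T.card.factorial : ℂ) * ∏ x ∈ T, q b x) + (if T = ∅ then 1 else 0)) =
        ((-1 : ℂ) ^ T.card * pairSum q a b T - (-1 : ℂ) ^ T.card * ((T.card.factorial : ℂ) * ∏ x ∈ T, q a x) -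
          (-1 : ℂ) ^ T.card * ((T.card.factorial : ℂ) * ∏ x ∈ T, q b x) + (if T = ∅ then 1 else 0)) +
          ((-1 : ℂ) ^ T.card * (if T = ∅ then (1 : ℂ) else 0) - (if T = ∅ then 1 else 0)) := by ring
    rw [split, key, hite, sub_self, add_zero]
  exact (mul_eq_zero.mp this).resolve_left hu

/-- **Mixed zeon-orthogonality kills every table (matrix form).**  Distinct points `a, b, c`; if on every benchmark column the
difference `P_b − P_a` is zeon-orthogonal to the point `P_c`, the rows `{b,c}, {a,c}, {b}, {a}` are dependent (`+ − − +`). -/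
theorem det_segMatrix_eq_zero_of_orthogonal_mixed {r : ℕ} (P : Fin h → Fin h → ℂ) (a b c : Fin h)
    (hab : a ≠ b) (hac : a ≠ c) (hbc : b ≠ c)
    (hyp : ∀ j : Fin r, ∀ x ∈ benchCols h r j, ∀ x' ∈ benchCols h r j, x ≠ x' →
      (P b x - P a x) * P c x' + (P b x' - P a x') * P c x = 0)
    (uu : Fin r → Finset (Fin h)) (hsurj : ∀ S : Finset (Fin h), S.card ≤ 2 → ∃ i, uu i = S) :
    (segMatrix r P uu).det = 0 := by
  classical
  set M := segMatrix r P uu with hM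
  have card2 : ∀ p q : Fin h, p ≠ q → ({p, q} : Finset (Fin h)).card ≤ 2 := fun p q hpq => by
    rw [Finset.card_pair hpq]
  obtain ⟨i₁, hi₁⟩ := hsurj {b, c} (card2 b c hbc)
  obtain ⟨i₂, hi₂⟩ := hsurj {a, c} (card2 a c hac)
  obtain ⟨i₃, hi₃⟩ := hsurj {b} (by rw [Finset.card_singleton]; omega)
  obtain ⟨i₄, hi₄⟩ := hsurj {a} (by rw [Finset.card_singleton]; omega)
  have n12 : i₁ ≠ i₂ := by
    intro e; rcases pair_eq_pair_iff b c a c (by rw [← hi₁, ← hi₂, e]) with ⟨h1, _⟩ | ⟨_, h2⟩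
    · exact hab h1.symm
    · exact hac h2.symm
  have n13 : i₁ ≠ i₃ := by
    intro e
    have e' := hi₁; rw [e, hi₃] at e'
    have := congrArg Finset.card e'
    rw [Finset.card_singleton, Finset.card_pair hbc] at this
    omega
  have n14 : i₁ ≠ i₄ := by
    intro e
    have e' := hi₁; rw [e, hi₄] at e'
    have := congrArg Finset.card e'
    rw [Finset.card_singleton, Finset.card_pair hbc] at this
    omega
  let v : Fin r → ℂ := Pi.single i₁ 1 - Pi.single i₂ 1 - Pi.single i₃ 1 + Pi.single i₄ 1
  have hv0 : v ≠ 0 := by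
    intro hv
    have := congr_fun hv i₁
    simp only [v, Pi.add_apply, Pi.sub_apply, Pi.single_eq_same, Pi.single_eq_of_ne n12, Pi.single_eq_of_ne n13,
      Pi.single_eq_of_ne n14, Pi.zero_apply] at this
    norm_num at this
  have hvM : Matrix.vecMul v M = 0 := by
    funext j
    simp only [v, Matrix.add_vecMul, Matrix.sub_vecMul, Matrix.single_one_vecMul, Pi.add_apply, Pi.sub_apply,
      Pi.zero_apply]
    have e3 := congr_fun (segMatrix_row_singleton P uu hi₃) j
    have e4 := congr_fun (segMatrix_row_singleton P uu hi₄) j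
    rw [hM, e3, e4, Matrix.row_apply, Matrix.row_apply, segMatrix_row_pair P uu hbc hi₁ j,
      segMatrix_row_pair P uu hac hi₂ j]
    exact pairSum_orthogonal_mixed P hac hbc (benchCols h r j) (hyp j)
  exact (Matrix.exists_vecMul_eq_zero_iff).mp ⟨v, hv0, hvM⟩

/-- **Two zeon-orthogonal points kill every table (matrix form).**  Distinct points `a, b`; if on every benchmark column the points
`P_a` and `P_b` are zeon-orthogonal (`P_{a,x}P_{b,x'} + P_{a,x'}P_{b,x} = 0` for distinct `x, x'` in the column — e.g. supports meeting no
common column pair), the rows `{a,b}, {a}, {b}, ∅` are dependent (`+ − − +`). -/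
theorem det_segMatrix_eq_zero_of_orthogonal_points {r : ℕ} (P : Fin h → Fin h → ℂ) (a b : Fin h) (hab : a ≠ b)
    (hyp : ∀ j : Fin r, ∀ x ∈ benchCols h r j, ∀ x' ∈ benchCols h r j, x ≠ x' →
      P a x * P b x' + P a x' * P b x = 0)
    (uu : Fin r → Finset (Fin h)) (hsurj : ∀ S : Finset (Fin h), S.card ≤ 2 → ∃ i, uu i = S) :
    (segMatrix r P uu).det = 0 := by
  classical
  set M := segMatrix r P uu with hM
  obtain ⟨i₁, hi₁⟩ := hsurj {a, b} (by rw [Finset.card_pair hab])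
  obtain ⟨i₂, hi₂⟩ := hsurj {a} (by rw [Finset.card_singleton]; omega)
  obtain ⟨i₃, hi₃⟩ := hsurj {b} (by rw [Finset.card_singleton]; omega)
  obtain ⟨i₄, hi₄⟩ := hsurj ∅ (by simp)
  have n12 : i₁ ≠ i₂ := by
    intro e
    have e' := hi₁; rw [e, hi₂] at e'
    have := congrArg Finset.card e'
    rw [Finset.card_singleton, Finset.card_pair hab] at this
    omega
  have n13 : i₁ ≠ i₃ := by
    intro e
    have e' := hi₁; rw [e, hi₃] at e'
    have := congrArg Finset.card e'
    rw [Finset.card_singleton, Finset.card_pair hab] at this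
    omega
  have n14 : i₁ ≠ i₄ := by
    intro e
    have e' := hi₁; rw [e, hi₄] at e'
    have := congrArg Finset.card e'
    rw [Finset.card_empty, Finset.card_pair hab] at this
    omega
  let v : Fin r → ℂ := Pi.single i₁ 1 - Pi.single i₂ 1 - Pi.single i₃ 1 + Pi.single i₄ 1
  have hv0 : v ≠ 0 := by
    intro hv
    have := congr_fun hv i₁
    simp only [v, Pi.add_apply, Pi.sub_apply, Pi.single_eq_same, Pi.single_eq_of_ne n12, Pi.single_eq_of_ne n13,
      Pi.single_eq_of_ne n14, Pi.zero_apply] at this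
    norm_num at this
  have hvM : Matrix.vecMul v M = 0 := by
    funext j
    simp only [v, Matrix.add_vecMul, Matrix.sub_vecMul, Matrix.single_one_vecMul, Pi.add_apply, Pi.sub_apply,
      Pi.zero_apply]
    have e2 := congr_fun (segMatrix_row_singleton P uu hi₂) j
    have e3 := congr_fun (segMatrix_row_singleton P uu hi₃) j
    have e4 := congr_fun (segMatrix_row_empty P uu hi₄) j
    rw [hM, e2, e3, e4, Matrix.row_apply, segMatrix_row_pair P uu hab hi₁ j]
    exact pairSum_orthogonal_origin P hab (benchCols h r j) (hyp j)
  exact (Matrix.exists_vecMul_eq_zero_iff).mp ⟨v, hv0, hvM⟩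

/-- **Mixed zeon-orthogonality — the line's form.** -/
theorem det_eq_zero_of_orthogonal_mixed {r : ℕ} (P : Fin h → Fin h → ℂ) (a b c : Fin h)
    (hab : a ≠ b) (hac : a ≠ c) (hbc : b ≠ c)
    (hyp : ∀ j : Fin r, ∀ x ∈ benchCols h r j, ∀ x' ∈ benchCols h r j, x ≠ x' →
      (P b x - P a x) * P c x' + (P b x' - P a x') * P c x = 0)
    (uu : Fin r → Finset (Fin h)) (hsurj : ∀ S : Finset (Fin h), S.card ≤ 2 → ∃ i, uu i = S) :
    (Matrix.of fun i j : Fin r =>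
      ∑ g : (↥(benchCols h r j) → ↥(uu i)), (∏ c : ↥(benchCols h r j), P (g c) c) *
        ∏ a : ↥(uu i), ((Finset.univ.filter fun c : ↥(benchCols h r j) => g c = a).card.factorial : ℂ)).det = 0 :=
  det_segMatrix_eq_zero_of_orthogonal_mixed P a b c hab hac hbc hyp uu hsurj

/-- **Two zeon-orthogonal points — the line's form.** -/
theorem det_eq_zero_of_orthogonal_points {r : ℕ} (P : Fin h → Fin h → ℂ) (a b : Fin h) (hab : a ≠ b)
    (hyp : ∀ j : Fin r, ∀ x ∈ benchCols h r j, ∀ x' ∈ benchCols h r j, x ≠ x' →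
      P a x * P b x' + P a x' * P b x = 0)
    (uu : Fin r → Finset (Fin h)) (hsurj : ∀ S : Finset (Fin h), S.card ≤ 2 → ∃ i, uu i = S) :
    (Matrix.of fun i j : Fin r =>
      ∑ g : (↥(benchCols h r j) → ↥(uu i)), (∏ c : ↥(benchCols h r j), P (g c) c) *
        ∏ a : ↥(uu i), ((Finset.univ.filter fun c : ↥(benchCols h r j) => g c = a).card.factorial : ℂ)).det = 0 :=
  det_segMatrix_eq_zero_of_orthogonal_points P a b hab hyp uu hsurj

end

end Summit.ValiantsHypothesis.ValiantsHypothesis.Theorems.BarrierLever.ChowBenchmarkHyperplane
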